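import Mathlib
import Literature.Computability.AlgebraicComplexity.GroupTheoreticMatMul
import Summits.MatrixMultiplication.MatrixMultiplication.Theses.ThinBlockAlpha

/-!
# Sketch for crux idea `ruled-graph-thin-designs` (crux stmt-MatrixMultiplication-10595, `ThinPackings`)

First lemma of the line: the RULED-GRAPH REDUCTION.  Host `H = P × V`, `P = ZMod q × ZMod q`
(incidence plane), `V` any finite abelian group (value layer).  Block `i` has two non-parallel
directions `d i, e i : P`, two value maps `f i, g i : ZMod q → V` and a multiplier set
`W i : Finset V`; its legs are the graphs `A i = {(x • d i, f i x)}`, `C i = {(y • e i, g i y)}`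
and the vertical set `B i = {0} × W i`.  `Condition` is the STPP clause of the tree's `IsSTPP`
written out in these coordinates (plane component and value component separately);
`Reduction` says it yields an `IsSTPP` family of blocks `⟨q, |W i|, q⟩` in a group of order
`q² · |V|`; `RuledGraphThinDesigns` is the transferred (stronger) form C⁺ of the crux and
`Transfer` the implication C⁺ → `ThinPackings`.
-/

open Literature.Computability.AlgebraicComplexity

namespace Summit.MatrixMultiplication.MatrixMultiplication.Cruxes.ThinPackings.RuledGraph

/-- The incidence plane. -/
abbrev Pl (q : ℕ) : Type := ZMod q × ZMod q

section Legs

variable {q : ℕ} [NeZero q] {V : Type} [AddCommGroup V] [DecidableEq V]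

/-- Long leg `A`: the graph of `f` over the line through `d`. -/
def legA (d : Pl q) (f : ZMod q → V) : Finset (Pl q × V) :=
  Finset.univ.image fun x : ZMod q => (x • d, f x)

/-- Long leg `C`: the graph of `g` over the line through `e`. -/
def legC (e : Pl q) (g : ZMod q → V) : Finset (Pl q × V) :=
  Finset.univ.image fun y : ZMod q => (y • e, g y)

/-- Short (multiplier) leg `B`: a vertical set `{0} × W`. -/
def legB (q : ℕ) (W : Finset V) : Finset (Pl q × V) :=
  W.image fun w => ((0 : Pl q), w)

/-- The STPP clause of `IsSTPP` in ruled-graph coordinates: `s' = (x' • d i, f i x') ∈ A i`,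
`s = (x • d k, f k x) ∈ A k`, `t = (0, w) ∈ B i`, `t' = (0, w') ∈ B j`, `u = (y • e j, g j y) ∈ C j`,
`u' = (y' • e k, g k y') ∈ C k`; the plane and value components of `(s'-s)+(t'-t)+(u'-u) = 0`. -/
def Condition {L : ℕ} (d e : Fin L → Pl q) (f g : Fin L → ZMod q → V)
    (W : Fin L → Finset V) : Prop :=
  ∀ i j k : Fin L, ∀ x x' y y' : ZMod q, ∀ w ∈ W i, ∀ w' ∈ W j,
    (x' • d i - x • d k) + (y' • e k - y • e j) = 0 →
    (f i x' - f k x) + (w' - w) + (g k y' - g j y) = 0 →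
    i = j ∧ j = k ∧ x = x' ∧ y = y' ∧ w = w'

/-- Pattern `i = j ≠ k` read fibrewise ("private stars"): centres `c i` with stars `W i - W i`
such that no other centre lies in `c i + (W i - W i)`.  Necessary for `Condition` at every plane
point (with `c i =` the tile function of block `i` at that point). -/
def PrivateStars {L : ℕ} (c : Fin L → V) (W : Fin L → Finset V) : Prop :=
  ∀ i k : Fin L, i ≠ k → ∀ w ∈ W i, ∀ w' ∈ W i, c k ≠ c i + (w - w')

end Legs

/-- FIRST LEMMA (the ruled-graph reduction): `Condition` makes the assembled family an `IsSTPP`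
family with `|A i| = |C i| = q` and `|B i| = |W i|` (injectivity of the leg parametrisations is
itself forced by `Condition` at `i = j = k`, using a witness `w ∈ W i` — hence the nonemptiness
hypothesis, without which the card claims fail for a degenerate block). Provable now; size M. -/
def Reduction : Prop :=
  ∀ (q : ℕ) [NeZero q] (V : Type) [AddCommGroup V] [Fintype V] [DecidableEq V] (L : ℕ)
    (d e : Fin L → Pl q) (f g : Fin L → ZMod q → V) (W : Fin L → Finset V),
    (∀ i, (W i).Nonempty) → Condition d e f g W →
      IsSTPP (fun i => legA (d i) (f i)) (fun i => legB q (W i)) (fun i => legC (e i) (g i)) ∧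
      ∀ i, (legA (d i) (f i)).card = q ∧ (legB q (W i)).card = (W i).card ∧
        (legC (e i) (g i)).card = q

/-- C⁺ (transferred, STRONGER form of the crux): ruled-graph thin designs exist for every shape
exponent `a < 1` and slack `η > 0`: common multiplier size `M ≥ q ^ a`, and the host
`q² · |V|` is at most `L · q^(2+η)`. -/
def RuledGraphThinDesigns : Prop :=
  ∀ a : ℝ, 0 ≤ a → a < 1 → ∀ η : ℝ, 0 < η →
    ∃ (q : ℕ) (_ : NeZero q) (V : Type) (_ : AddCommGroup V) (_ : Fintype V) (_ : DecidableEq V)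
      (L M : ℕ) (d e : Fin L → Pl q) (f g : Fin L → ZMod q → V) (W : Fin L → Finset V),
      2 ≤ q ∧ (∀ i, (W i).Nonempty) ∧ Condition d e f g W ∧ (∀ i, (W i).card = M) ∧
        (q : ℝ) ^ a ≤ M ∧
        (q : ℝ) ^ 2 * Fintype.card V ≤ L * (q : ℝ) ^ (2 + η)

/-- TRANSFER: the reduction plus C⁺ give the crux verbatim (host `H := Pl q × V`, `N := q`).
Pure bookkeeping once `Reduction` is proved. -/
def Transfer : Prop :=
  Reduction → RuledGraphThinDesigns →
    Summit.MatrixMultiplication.MatrixMultiplication.Theses.ThinBlockAlpha.ThinPackings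

/-- Harmless rigorous cap inside the model (per-`A`-direction packing of the multipliers in `V`,
pattern `i ≠ j = k` with `d i = d k`): blocks sharing the SAME direction vector `d` have
`∑ |W i| ≤ |V|`.  With `q + 1` directions this only re-proves `L·N·M ≲ |H|`; it does NOT cap the
model at the coset bound `L·N²·M ≤ |H|`. -/
def PerDirectionCap : Prop :=
  ∀ (q : ℕ) [NeZero q] (V : Type) [AddCommGroup V] [Fintype V] [DecidableEq V] (L : ℕ)
    (d e : Fin L → Pl q) (f g : Fin L → ZMod q → V) (W : Fin L → Finset V),
    Condition d e f g W → ∀ i₀ : Fin L,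
      ∑ i ∈ Finset.univ.filter (fun i => d i = d i₀), (W i).card ≤ Fintype.card V


/-- `Transfer` PROVED: the bookkeeping from C⁺ and the reduction to the crux BY NAME. -/
theorem transfer_holds : Transfer := by
  intro hR hC a ha0 ha1 η hη
  obtain ⟨q, hne, V, hV1, hV2, hV3, L, M, d, e, f, g, W, hq, hWne, hcond, hW, hM, hP⟩ :=
    hC a ha0 ha1 η hη
  obtain ⟨hS, hcard⟩ := hR q V L d e f g W hWne hcond
  refine ⟨Pl q × V, inferInstance, inferInstance, L, q, M, fun i => legA (d i) (f i),
    fun i => legB q (W i), fun i => legC (e i) (g i), hS, ?_, hq, hM, ?_⟩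
  · intro i
    obtain ⟨h1, h2, h3⟩ := hcard i
    exact ⟨h1, by rw [h2, hW i], h3⟩
  · have hc : (Fintype.card (Pl q × V) : ℝ) = (q : ℝ) ^ 2 * Fintype.card V := by
      rw [Fintype.card_prod, Fintype.card_prod, ZMod.card]
      push_cast
      ring
    rw [hc]
    exact hP

end Summit.MatrixMultiplication.MatrixMultiplication.Cruxes.ThinPackings.RuledGraph
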